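import Summits.Parity.GeneralizedHardyLittlewood.Theorems.LeeYangFibresAbsoluteUpgradeModGammaDefs
import Literature.Analysis.Complex.CauchyTaylorBall
import HarnessLib

/-!
# Route `LeeYangFibres`, crux `AbsoluteUpgrade` (stmt-Parity-14116), line `dip-margin-rate-exchange`:
# the adjoint method for `ModGammaDisc` — kernel estimates (helper #1 for the stub `mg_adjointEq`)

Helper file for the registered stub `mg_adjointEq : MGEin → MGAdjointEq` (the adjoint equation
`d/dv [v g̃_z(v)] = -z g̃_z(v+1)` for the regularised `Γ`-normalised adjoint `adjTilde` of the
vocabulary file `LeeYangFibresAbsoluteUpgradeModGammaDefs.lean`). Everything here is about the kernel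
`φ_z(x) = exp(-z Ein x)` (`phiZ`) under the hypothesis `MGEin` (the complex `Ein` is entire, agrees with the
tree's real `Literature.NumberTheory.Sieve.ein`, and `‖Ein x‖ ≤ ‖x‖e^{‖x‖}`):

* `AdjEq.hasDerivAt_phiZ_ofReal` — the kernel identity `φ_z' = -z Ein' φ_z` along the reals;
* growth: `‖φ_z(x)‖ ≤ exp(‖z‖ Ein x) ≤ e^{‖z‖}(1 + x^{‖z‖})` on `[0, ∞)` (`Ein x ≤ 1 + log x` for
  `x ≥ 1`), and `‖φ_z‖ ≤ exp(‖z‖e)` on the unit disc;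
* Cauchy–Taylor at `0` (tree `Literature/Analysis/Complex/CauchyTaylorBall.lean`): the remainder bound
  `‖φ_z(x) - Σ_{k<N} p_k(z)x^k‖ ≤ 2e^{‖z‖e}(2‖x‖)^N` (`‖x‖ ≤ 1/4`) and `‖p_k(z)‖ ≤ e^{‖z‖e}2^k`;
* `mg_adjointEq_kernelMajorant` (registered helper) — the UNIFORM MAJORANT of the regularised kernel:
  `‖x^{z+N} R_N(z,x)‖ ≤ C(N,Λ)·(x^{σ+N} + x^{2Λ+2N})` for all `x > 0`, `‖z‖ ≤ Λ`, `Re z ≥ σ` (`σ + N ≤ 1`),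
  which makes every Laplace integral `∫_0^∞ e^{-vx} x^{z+N} R_N(z,x) dx` of the method absolutely
  convergent, differentiable in `v` and holomorphic in `z`, locally uniformly.

References: G. Greaves, *Sieves in Number Theory* (2001), §4.2.3 (adjoint functions as Laplace
transforms) [Greaves2001]; the tree's `Literature/NumberTheory/Sieve/SieveAdjointP.lean` (the `x^z`-free
template `rosserAdjointP`).
-/

noncomputable section

namespace Summit.Parity.GeneralizedHardyLittlewood.Cruxes.AbsoluteUpgrade.DipMarginRateExchange

open scoped BigOperators
open MeasureTheory Set Filter Topology
open Literature.NumberTheory.Sieve (ein einKernel)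

namespace AdjEq

/-! ## The kernel `φ_z` -/

/-- `φ_z = exp(-z·Ein)` is entire (from `MGEin`: `einC` is entire). -/
theorem differentiable_phiZ (hE : MGEin) (z : ℂ) : Differentiable ℂ (phiZ z) :=
  ((differentiable_const z).mul hE.1).neg.cexp

/-- `φ_z` is continuous. -/
theorem continuous_phiZ (hE : MGEin) (z : ℂ) : Continuous (phiZ z) :=
  (differentiable_phiZ hE z).continuous

/-- The sup bound `‖φ_z(x)‖ ≤ exp(‖z‖ ‖x‖ e^{‖x‖})` (from `‖Ein x‖ ≤ ‖x‖ e^{‖x‖}` in `MGEin`). -/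
theorem norm_phiZ_le (hE : MGEin) (z x : ℂ) :
    ‖phiZ z x‖ ≤ Real.exp (‖z‖ * (‖x‖ * Real.exp ‖x‖)) := by
  rw [phiZ, Complex.norm_exp, Real.exp_le_exp]
  calc (-(z * einC x)).re ≤ ‖-(z * einC x)‖ := Complex.re_le_norm _
    _ = ‖z‖ * ‖einC x‖ := by rw [norm_neg, norm_mul]
    _ ≤ ‖z‖ * (‖x‖ * Real.exp ‖x‖) := mul_le_mul_of_nonneg_left (hE.2.2 x) (norm_nonneg z)

/-- On the reals `φ_z(x) = exp(-z Ein x)` with the tree's real `ein`. -/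
theorem phiZ_ofReal (hE : MGEin) (z : ℂ) (x : ℝ) :
    phiZ z x = Complex.exp (-(z * (ein x : ℂ))) := by
  rw [phiZ, hE.2.1 x]

/-- The kernel identity in derivative form: `d/dx φ_z(x) = -z Ein'(x) φ_z(x)` along the reals, `Ein' =
einKernel = (1 - e^{-x})/x` (tree `hasDerivAt_ein`). -/
theorem hasDerivAt_phiZ_ofReal (hE : MGEin) (z : ℂ) (x : ℝ) :
    HasDerivAt (fun t : ℝ => phiZ z t) (-(z * (einKernel x : ℂ)) * phiZ z x) x := by
  have h1 : HasDerivAt (fun t : ℝ => ((ein t : ℝ) : ℂ)) ((einKernel x : ℝ) : ℂ) x :=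
    (Literature.NumberTheory.Sieve.hasDerivAt_ein x).ofReal_comp
  have h2 : HasDerivAt (fun t : ℝ => -(z * ((ein t : ℝ) : ℂ))) (-(z * ((einKernel x : ℝ) : ℂ))) x :=
    (h1.const_mul z).neg
  have h3 := h2.cexp
  have hfun : (fun t : ℝ => phiZ z t) = fun t : ℝ => Complex.exp (-(z * ((ein t : ℝ) : ℂ))) := by
    funext t; exact phiZ_ofReal hE z t
  rw [hfun]
  convert h3 using 1
  rw [← phiZ_ofReal hE z x]; ring

/-- `‖φ_z(x)‖ ≤ exp(‖z‖ Ein x)` for real `x ≥ 0`. -/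
theorem norm_phiZ_ofReal_le (hE : MGEin) (z : ℂ) {x : ℝ} (hx : 0 ≤ x) :
    ‖phiZ z x‖ ≤ Real.exp (‖z‖ * ein x) := by
  rw [phiZ_ofReal hE, Complex.norm_exp, Real.exp_le_exp]
  have hre : (-(z * (ein x : ℂ))).re = (-z.re) * ein x := by
    simp [Complex.mul_re]
  rw [hre]
  have h0 : 0 ≤ ein x := Literature.NumberTheory.Sieve.ein_nonneg hx
  have h1 : -z.re ≤ ‖z‖ := by linarith [Complex.abs_re_le_norm z, neg_le_abs z.re]
  exact mul_le_mul_of_nonneg_right h1 h0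

/-- Logarithmic growth of `Ein`: `Ein x ≤ 1 + log x` for `x ≥ 1` (`Ein 1 ≤ 1` and `Ein' t = (1 -
e^{-t})/t ≤ 1/t`). [folklore] -/
theorem ein_le_one_add_log {x : ℝ} (hx : 1 ≤ x) : ein x ≤ 1 + Real.log x := by
  have hc := Literature.NumberTheory.Sieve.continuous_einKernel
  have hsplit : ein x = ein 1 + ∫ t in (1:ℝ)..x, einKernel t := by
    rw [Literature.NumberTheory.Sieve.ein, Literature.NumberTheory.Sieve.ein,
      intervalIntegral.integral_add_adjacent_intervals (hc.intervalIntegrable 0 1)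
        (hc.intervalIntegrable 1 x)]
  have h1 : ein 1 ≤ 1 := Literature.NumberTheory.Sieve.ein_le_self zero_le_one
  have h2 : ∫ t in (1:ℝ)..x, einKernel t ≤ ∫ t in (1:ℝ)..x, t⁻¹ := by
    refine intervalIntegral.integral_mono_on hx (hc.intervalIntegrable 1 x) ?_ fun t ht => ?_
    · refine intervalIntegral.intervalIntegrable_inv (fun t ht => ?_) continuousOn_id
      rw [uIcc_of_le hx] at ht
      exact ne_of_gt (lt_of_lt_of_le one_pos ht.1)
    · have ht0 : 0 < t := lt_of_lt_of_le one_pos ht.1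
      rw [Literature.NumberTheory.Sieve.einKernel_eq_div ht0.ne', ← one_div]
      exact div_le_div_of_nonneg_right (by linarith [Real.exp_pos (-t)]) ht0.le
  have h3 : ∫ t in (1:ℝ)..x, t⁻¹ = Real.log x := by
    rw [integral_inv, div_one]
    rw [uIcc_of_le hx]
    exact fun h => absurd h.1 (by norm_num)
  linarith

/-- Polynomial growth of the kernel: `‖φ_z(x)‖ ≤ e^{‖z‖} x^{‖z‖}` for `x ≥ 1`. -/
theorem norm_phiZ_ofReal_le_of_one_le (hE : MGEin) (z : ℂ) {x : ℝ} (hx : 1 ≤ x) :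
    ‖phiZ z x‖ ≤ Real.exp ‖z‖ * x ^ ‖z‖ := by
  have h0 : (0:ℝ) < x := by linarith
  calc ‖phiZ z x‖ ≤ Real.exp (‖z‖ * ein x) := norm_phiZ_ofReal_le hE z h0.le
    _ ≤ Real.exp (‖z‖ * (1 + Real.log x)) := by
        rw [Real.exp_le_exp]
        exact mul_le_mul_of_nonneg_left (ein_le_one_add_log hx) (norm_nonneg z)
    _ = Real.exp ‖z‖ * x ^ ‖z‖ := by
        rw [mul_add, mul_one, Real.exp_add, Real.rpow_def_of_pos h0, mul_comm (Real.log x)]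

/-- `‖φ_z(x)‖ ≤ e^{‖z‖} (1 + x^{‖z‖})` for all real `x ≥ 0`. -/
theorem norm_phiZ_ofReal_le_rpow (hE : MGEin) (z : ℂ) {x : ℝ} (hx : 0 ≤ x) :
    ‖phiZ z x‖ ≤ Real.exp ‖z‖ * (1 + x ^ ‖z‖) := by
  have hxz : 0 ≤ x ^ ‖z‖ := Real.rpow_nonneg hx _
  rcases le_or_gt 1 x with h1 | h1
  · calc ‖phiZ z x‖ ≤ Real.exp ‖z‖ * x ^ ‖z‖ := norm_phiZ_ofReal_le_of_one_le hE z h1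
      _ ≤ Real.exp ‖z‖ * (1 + x ^ ‖z‖) := by gcongr; linarith
  · calc ‖phiZ z x‖ ≤ Real.exp (‖z‖ * ein x) := norm_phiZ_ofReal_le hE z hx
      _ ≤ Real.exp ‖z‖ := by
          rw [Real.exp_le_exp]
          have h2 : ein x ≤ 1 := (Literature.NumberTheory.Sieve.ein_le_self hx).trans h1.le
          calc ‖z‖ * ein x ≤ ‖z‖ * 1 := mul_le_mul_of_nonneg_left h2 (norm_nonneg z)
            _ = ‖z‖ := mul_one _
      _ ≤ Real.exp ‖z‖ * (1 + x ^ ‖z‖) := by nlinarith [Real.exp_pos ‖z‖]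

/-- Sup bound on the unit disc: `‖φ_z(x)‖ ≤ exp(‖z‖ e)` for `‖x‖ < 1`. -/
theorem norm_phiZ_le_of_norm_lt_one (hE : MGEin) (z : ℂ) {x : ℂ} (hx : ‖x‖ < 1) :
    ‖phiZ z x‖ ≤ Real.exp (‖z‖ * Real.exp 1) := by
  refine (norm_phiZ_le hE z x).trans ?_
  rw [Real.exp_le_exp]
  refine mul_le_mul_of_nonneg_left ?_ (norm_nonneg z)
  calc ‖x‖ * Real.exp ‖x‖ ≤ 1 * Real.exp 1 :=
        mul_le_mul hx.le (Real.exp_le_exp.mpr hx.le) (Real.exp_pos _).le zero_le_one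
    _ = Real.exp 1 := one_mul _

/-- Sup bound on the unit ball, in the form consumed by the Cauchy–Taylor lemmas of
`Literature/Analysis/Complex/CauchyTaylorBall.lean`. -/
theorem norm_phiZ_le_of_mem_ball (hE : MGEin) (z : ℂ) :
    ∀ y ∈ Metric.ball (0:ℂ) 1, ‖phiZ z y‖ ≤ Real.exp (‖z‖ * Real.exp 1) := fun y hy =>
  norm_phiZ_le_of_norm_lt_one hE z (by rwa [Metric.mem_ball, dist_zero_right] at hy)

/-- **Cauchy–Taylor remainder bound** for `φ_z` at `0`: `‖φ_z(x) - Σ_{k<N} p_k(z) x^k‖ ≤ 2 exp(‖z‖e)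
(2‖x‖)^N` for `‖x‖ ≤ 1/4` (`Literature.Analysis.Complex.norm_sub_taylor_le_of_forall_mem_ball` with
the sup bound on the unit ball). -/
theorem norm_phiZ_sub_sum_le (hE : MGEin) (z : ℂ) (N : ℕ) {x : ℂ} (hx : ‖x‖ ≤ 1 / 4) :
    ‖phiZ z x - ∑ k ∈ Finset.range N, pCoeff z k * x ^ k‖ ≤
      2 * Real.exp (‖z‖ * Real.exp 1) * (2 * ‖x‖) ^ N := by
  have hx' : ‖x - 0‖ ≤ 1 / 4 := by rwa [sub_zero]
  have h := Literature.Analysis.Complex.norm_sub_taylor_le_of_forall_mem_ball one_pos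
    (differentiable_phiZ hE z).differentiableOn (norm_phiZ_le_of_mem_ball hE z) hx' N
  simp only [sub_zero, div_one, smul_eq_mul] at h
  have hsum : ∑ k ∈ Finset.range N, pCoeff z k * x ^ k =
      ∑ n ∈ Finset.range N, (n.factorial : ℂ)⁻¹ * (x ^ n * iteratedDeriv n (phiZ z) 0) :=
    Finset.sum_congr rfl fun k _ => by rw [pCoeff]; ring
  rw [hsum]
  exact h

/-- **Cauchy estimate for the Taylor coefficients**: `‖p_k(z)‖ ≤ exp(‖z‖ e) 2^k`. -/
theorem norm_pCoeff_le (hE : MGEin) (z : ℂ) (k : ℕ) :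
    ‖pCoeff z k‖ ≤ Real.exp (‖z‖ * Real.exp 1) * 2 ^ k := by
  have h := Literature.Analysis.Complex.norm_iteratedDeriv_le_of_forall_mem_ball one_pos
    (differentiable_phiZ hE z).differentiableOn (norm_phiZ_le_of_mem_ball hE z) k
  rw [pCoeff, norm_mul, norm_inv, Complex.norm_natCast]
  have hk : (0:ℝ) < k.factorial := by exact_mod_cast Nat.factorial_pos k
  rw [inv_mul_le_iff₀ hk]
  calc ‖iteratedDeriv k (phiZ z) 0‖ ≤ k.factorial * Real.exp (‖z‖ * Real.exp 1) / (1 / 2) ^ k := h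
    _ = k.factorial * (Real.exp (‖z‖ * Real.exp 1) * 2 ^ k) := by
        rw [one_div, inv_pow, div_inv_eq_mul]; ring
/-! ## The regularised kernel on the positive reals -/

/-- On the positive reals the regularised kernel is `x^{z+N} R_N(z,x) = x^z (φ_z(x) - Σ_{k<N} p_k(z)
x^k)`. -/
theorem cpow_mul_remZ {x : ℝ} (hx : 0 < x) (N : ℕ) (z : ℂ) :
    (x : ℂ) ^ (z + (N : ℂ)) * remZ N z x =
      (x : ℂ) ^ z * (phiZ z x - ∑ k ∈ Finset.range N, pCoeff z k * (x : ℂ) ^ k) := by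
  have hx0 : (x : ℂ) ≠ 0 := Complex.ofReal_ne_zero.mpr hx.ne'
  have hxN : (x : ℂ) ^ N ≠ 0 := pow_ne_zero _ hx0
  rw [remZ, Complex.cpow_add _ _ hx0, Complex.cpow_natCast, mul_assoc, mul_div_cancel₀ _ hxN]

/-- **Uniform majorant of the regularised kernel**: for `‖z‖ ≤ Λ`, `Re z ≥ σ` (`σ + N ≤ 1`) and all `x >
0`, `‖x^{z+N} R_N(z,x)‖ ≤ C (x^{σ+N} + x^{2Λ+2N})` with `C = C(N, Λ)` (Cauchy–Taylor for `x ≤ 1/4`;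
the coefficient bound and the polynomial growth of `φ_z` for `x > 1/4`). -/
theorem norm_cpow_mul_remZ_le (hE : MGEin) (N : ℕ) {Λ σ : ℝ} (hΛ : 0 ≤ Λ)
    (hσ1 : σ + N ≤ 1) :
    ∃ C : ℝ, 0 ≤ C ∧ ∀ z : ℂ, ‖z‖ ≤ Λ → σ ≤ z.re → ∀ x : ℝ, 0 < x →
      ‖(x : ℂ) ^ (z + (N : ℂ)) * remZ N z x‖ ≤ C * (x ^ (σ + N) + x ^ (2 * Λ + 2 * N)) := by
  set M : ℝ := Real.exp (Λ * Real.exp 1) with hM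
  set C₁ : ℝ := 2 ^ (N + 1) * M with hC₁
  set C₂ : ℝ := Real.exp Λ + N * M * 2 ^ N with hC₂
  have hM0 : 0 < M := Real.exp_pos _
  have hC₁0 : 0 ≤ C₁ := by positivity
  have hC₂0 : 0 ≤ C₂ := by positivity
  set C : ℝ := C₁ + 4 * 4 ^ Λ * C₂ + C₂ with hC
  have h44 : 0 ≤ 4 * 4 ^ Λ * C₂ := by positivity
  have hC0 : 0 ≤ C := by positivity
  have hC₁C : C₁ ≤ C := by rw [hC]; linarith
  have hC₂C : C₂ ≤ C := by rw [hC]; linarith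
  have hC₃C : 4 * 4 ^ Λ * C₂ ≤ C := by rw [hC]; linarith
  refine ⟨C, hC0, fun z hzΛ hzσ x hx => ?_⟩
  have hMz : Real.exp (‖z‖ * Real.exp 1) ≤ M := by rw [hM, Real.exp_le_exp]; gcongr
  rw [cpow_mul_remZ hx, norm_mul, Complex.norm_cpow_eq_rpow_re_of_pos hx]
  set D := phiZ z x - ∑ k ∈ Finset.range N, pCoeff z k * (x : ℂ) ^ k with hD
  have hxa : 0 ≤ x ^ (σ + N) := Real.rpow_nonneg hx.le _
  have hxb : 0 ≤ x ^ (2 * Λ + 2 * N) := Real.rpow_nonneg hx.le _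
  have hfinal : ∀ {K t : ℝ}, 0 ≤ K → K ≤ C → 0 ≤ t → t ≤ x ^ (σ + N) + x ^ (2 * Λ + 2 * N) →
      K * t ≤ C * (x ^ (σ + N) + x ^ (2 * Λ + 2 * N)) := fun hK hKC ht htle =>
    mul_le_mul hKC htle ht hC0
  have hpk : ∀ k, ‖pCoeff z k‖ ≤ M * 2 ^ k := fun k => (norm_pCoeff_le hE z k).trans (by gcongr)
  have hxnorm : ‖(x : ℂ)‖ = x := by rw [Complex.norm_real, Real.norm_of_nonneg hx.le]
  rcases le_or_gt x (1/4) with hx4 | hx4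
  · -- small `x`: Cauchy–Taylor
    have hxn : ‖(x:ℂ)‖ ≤ 1/4 := by rw [hxnorm]; exact hx4
    have hT := norm_phiZ_sub_sum_le hE z N hxn
    rw [hxnorm] at hT
    have hx1 : x ≤ 1 := by linarith
    calc x ^ z.re * ‖D‖ ≤ x ^ z.re * (2 * M * (2 * x) ^ N) := by
          refine mul_le_mul_of_nonneg_left (hT.trans ?_) (Real.rpow_nonneg hx.le _)
          gcongr
      _ = C₁ * (x ^ z.re * x ^ (N:ℝ)) := by rw [hC₁, mul_pow, Real.rpow_natCast]; ring
      _ = C₁ * x ^ (z.re + N) := by rw [← Real.rpow_add hx]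
      _ ≤ C₁ * x ^ (σ + N) := by
          refine mul_le_mul_of_nonneg_left ?_ hC₁0
          exact Real.rpow_le_rpow_of_exponent_ge hx hx1 (by linarith)
      _ ≤ C * (x ^ (σ + N) + x ^ (2 * Λ + 2 * N)) := hfinal hC₁0 hC₁C hxa (by linarith)
  · -- `x > 1/4`
    have hDle : ‖D‖ ≤ ‖phiZ z x‖ + ∑ k ∈ Finset.range N, M * 2 ^ k * x ^ k := by
      refine (norm_sub_le _ _).trans (add_le_add le_rfl ?_)
      refine (norm_sum_le _ _).trans (Finset.sum_le_sum fun k _ => ?_)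
      rw [norm_mul, norm_pow, hxnorm]
      exact mul_le_mul_of_nonneg_right (hpk k) (pow_nonneg hx.le k)
    rcases le_or_gt 1 x with hx1 | hx1
    · -- `x ≥ 1`
      have hsum : ∑ k ∈ Finset.range N, M * 2 ^ k * x ^ k ≤ N * M * 2 ^ N * x ^ N := by
        calc ∑ k ∈ Finset.range N, M * 2 ^ k * x ^ k
            ≤ ∑ k ∈ Finset.range N, M * 2 ^ N * x ^ N := by
              refine Finset.sum_le_sum fun k hk => ?_
              have hkN : k ≤ N := (Finset.mem_range.mp hk).le
              have h2k : (2:ℝ) ^ k ≤ 2 ^ N := pow_le_pow_right₀ (by norm_num) hkN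
              have hxk : x ^ k ≤ x ^ N := pow_le_pow_right₀ hx1 hkN
              exact mul_le_mul (mul_le_mul_of_nonneg_left h2k hM0.le) hxk (pow_nonneg hx.le k)
                (by positivity)
          _ = N * M * 2 ^ N * x ^ N := by
              rw [Finset.sum_const, Finset.card_range, nsmul_eq_mul]; ring
      have hφ : ‖phiZ z x‖ ≤ Real.exp Λ * x ^ Λ := by
        calc ‖phiZ z x‖ ≤ Real.exp ‖z‖ * x ^ ‖z‖ := norm_phiZ_ofReal_le_of_one_le hE z hx1
          _ ≤ Real.exp Λ * x ^ Λ :=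
              mul_le_mul (Real.exp_le_exp.mpr hzΛ) (Real.rpow_le_rpow_of_exponent_le hx1 hzΛ)
                (Real.rpow_nonneg hx.le _) (Real.exp_pos Λ).le
      have hxre : x ^ z.re ≤ x ^ Λ :=
        Real.rpow_le_rpow_of_exponent_le hx1 ((Complex.re_le_norm z).trans hzΛ)
      have hxΛ0 : 0 ≤ x ^ Λ := Real.rpow_nonneg hx.le _
      have hbig : x ^ z.re * ‖D‖ ≤ C₂ * x ^ (2 * Λ + 2 * N) := by
        calc x ^ z.re * ‖D‖ ≤ x ^ Λ * (Real.exp Λ * x ^ Λ + N * M * 2 ^ N * x ^ N) :=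
              mul_le_mul hxre (hDle.trans (add_le_add hφ hsum)) (norm_nonneg _) hxΛ0
          _ = Real.exp Λ * (x ^ Λ * x ^ Λ) + N * M * 2 ^ N * (x ^ Λ * x ^ (N:ℝ)) := by
              rw [Real.rpow_natCast]; ring
          _ = Real.exp Λ * x ^ (Λ + Λ) + N * M * 2 ^ N * x ^ (Λ + N) := by
              rw [← Real.rpow_add hx, ← Real.rpow_add hx]
          _ ≤ Real.exp Λ * x ^ (2 * Λ + 2 * N) + N * M * 2 ^ N * x ^ (2 * Λ + 2 * N) := by
              have hN0 : (0:ℝ) ≤ N := Nat.cast_nonneg N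
              have e1 : x ^ (Λ + Λ) ≤ x ^ (2 * Λ + 2 * N) :=
                Real.rpow_le_rpow_of_exponent_le hx1 (by linarith)
              have e2 : x ^ (Λ + N) ≤ x ^ (2 * Λ + 2 * N) :=
                Real.rpow_le_rpow_of_exponent_le hx1 (by linarith)
              exact add_le_add (mul_le_mul_of_nonneg_left e1 (Real.exp_pos Λ).le)
                (mul_le_mul_of_nonneg_left e2 (by positivity))
          _ = C₂ * x ^ (2 * Λ + 2 * N) := by rw [hC₂]; ring
      exact hbig.trans (hfinal hC₂0 hC₂C hxb (by linarith))
    · -- `1/4 < x < 1`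
      have hsum : ∑ k ∈ Finset.range N, M * 2 ^ k * x ^ k ≤ N * M * 2 ^ N := by
        calc ∑ k ∈ Finset.range N, M * 2 ^ k * x ^ k
            ≤ ∑ k ∈ Finset.range N, M * 2 ^ N * 1 := by
              refine Finset.sum_le_sum fun k hk => ?_
              have hkN : k ≤ N := (Finset.mem_range.mp hk).le
              have h2k : (2:ℝ) ^ k ≤ 2 ^ N := pow_le_pow_right₀ (by norm_num) hkN
              have hxk : x ^ k ≤ 1 := pow_le_one₀ hx.le hx1.le
              exact mul_le_mul (mul_le_mul_of_nonneg_left h2k hM0.le) hxk (pow_nonneg hx.le k)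
                (by positivity)
          _ = N * M * 2 ^ N := by
              rw [Finset.sum_const, Finset.card_range, nsmul_eq_mul]; ring
      have hφ : ‖phiZ z x‖ ≤ Real.exp Λ := by
        calc ‖phiZ z x‖ ≤ Real.exp (‖z‖ * ein x) := norm_phiZ_ofReal_le hE z hx.le
          _ ≤ Real.exp Λ := by
              rw [Real.exp_le_exp]
              have h1 : ein x ≤ 1 := (Literature.NumberTheory.Sieve.ein_le_self hx.le).trans hx1.le
              have h2 : 0 ≤ ein x := Literature.NumberTheory.Sieve.ein_nonneg hx.le
              calc ‖z‖ * ein x ≤ Λ * 1 := mul_le_mul hzΛ h1 h2 hΛ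
                _ = Λ := mul_one Λ
      have hxre : x ^ z.re ≤ 4 ^ Λ := by
        have hre : -Λ ≤ z.re := by linarith [Complex.abs_re_le_norm z, neg_abs_le z.re]
        calc x ^ z.re ≤ x ^ (-Λ) := Real.rpow_le_rpow_of_exponent_ge hx hx1.le hre
          _ = (x⁻¹) ^ Λ := by rw [Real.rpow_neg hx.le, Real.inv_rpow hx.le]
          _ ≤ 4 ^ Λ := by
              refine Real.rpow_le_rpow (inv_nonneg.mpr hx.le) ?_ hΛ
              rw [inv_le_comm₀ hx (by norm_num)]
              linarith
      have h1 : x ≤ x ^ (σ + N) := by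
        calc x = x ^ (1:ℝ) := (Real.rpow_one x).symm
          _ ≤ x ^ (σ + N) := Real.rpow_le_rpow_of_exponent_ge hx hx1.le hσ1
      have h4C : 0 ≤ 4 ^ Λ * C₂ := by positivity
      calc x ^ z.re * ‖D‖ ≤ 4 ^ Λ * (Real.exp Λ + N * M * 2 ^ N) :=
            mul_le_mul hxre (hDle.trans (add_le_add hφ hsum)) (norm_nonneg _) (by positivity)
        _ = 4 ^ Λ * C₂ * 1 := by rw [hC₂, mul_one]
        _ ≤ 4 ^ Λ * C₂ * (4 * x) := mul_le_mul_of_nonneg_left (by linarith) h4C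
        _ = (4 * 4 ^ Λ * C₂) * x := by ring
        _ ≤ (4 * 4 ^ Λ * C₂) * x ^ (σ + N) := mul_le_mul_of_nonneg_left h1 h44
        _ ≤ C * (x ^ (σ + N) + x ^ (2 * Λ + 2 * N)) := hfinal h44 hC₃C hxa (by linarith)

end AdjEq

/-- **Uniform majorant of the regularised kernel** (registered helper for the stub `mg_adjointEq`, line
`dip-margin-rate-exchange`): for `‖z‖ ≤ Λ`, `Re z ≥ σ` with `σ + N ≤ 1`, and all `x > 0`,
`‖x^{z+N} R_N(z,x)‖ ≤ C (x^{σ+N} + x^{2Λ+2N})`. -/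
theorem mg_adjointEq_kernelMajorant : MGEin → ∀ N : ℕ, ∀ Λ σ : ℝ, 0 ≤ Λ → σ + N ≤ 1 → ∃ C : ℝ, 0 ≤ C ∧ ∀ z : ℂ, ‖z‖ ≤ Λ → σ ≤ z.re → ∀ x : ℝ, 0 < x → ‖(x : ℂ) ^ (z + (N : ℂ)) * remZ N z x‖ ≤ C * (x ^ (σ + N) + x ^ (2 * Λ + 2 * N)) :=
  fun hE N _ _ hΛ hσ1 => AdjEq.norm_cpow_mul_remZ_le hE N hΛ hσ1

end Summit.Parity.GeneralizedHardyLittlewood.Cruxes.AbsoluteUpgrade.DipMarginRateExchange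

end
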